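import Literature.NumberTheory.GaloisRepresentations.SerreOpenImageGroupLemmas
import HarnessLib

/-!
# Class X9, twisted hypothesis (im): the `GL₂(𝔽_p)` lemma, I (`p ≠ 5` and general tools)

HONEST FRAMING (cell `b2b-bsdres`, X9 prover lineage): this file is pure group theory in
`GL₂(𝔽_p)` serving the kernel proof of the obligation node
`Summit.BirchSwinnertonDyer.BirchSwinnertonDyer.Rank1Residual.X9TwistedHypothesisIm`
(`Theorems/Rank1ResidualX9SmallImageKolyvagin`, cell `bsd-smallim`): the mod-`p` image of an
X9 pair contains an element of determinant `1` with an `𝔽_p`-rational eigenvalue `a`, `a² ≠ 1`.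
Nothing here is about elliptic curves; no class-level claim is made.  The case `p = 5` and the
assembled statement for all `p ≥ 5` are in the sequel `Rank1ResidualX9TwistedImGL2Five`.

**Theorem** (`exists_det_one_eigenvalue_sq_ne_one_of_ne_five`).  Let `p ≥ 7` and let
`G ⊆ GL₂(𝔽_p)` be a proper subgroup containing a split half-Cartan subgroup `P (1 0; 0 *) P⁻¹`
(the shape of inertia at a prime of good ordinary reduction, Serre 1972 §1.11) and acting
irreducibly on `𝔽_p²` (no common eigenvector).  Then some `h ∈ G` has `det h = 1` and an
eigenvector `v ≠ 0` with `h v = a v`, `a ∈ 𝔽_pˣ`, `a² ≠ 1`.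

Proof.  By Serre's Prop. 17 (half-Cartan form, tree `Serre1972.prop17_cases_halfSplitCartan`)
`G` normalises a Cartan subgroup `C`, which by Prop. 14
(`eq_splitCartan_of_halfSplitCartan_le_normalizer`) is the split Cartan subgroup
`P (* 0; 0 *) P⁻¹`; irreducibility gives `w ∈ G ∖ C`, which swaps the two lines of `C` (n° 2.2),
so `w · P diag(1,u) P⁻¹ · w⁻¹ = P diag(u,1) P⁻¹` and
`h = P diag(1,u⁻¹) P⁻¹ · P diag(u,1) P⁻¹ = P diag(u, u⁻¹) P⁻¹ ∈ G` works (`u² ≠ 1` exists as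
`p ≥ 5`): the **swap construction** `exists_mem_det_eq_one_mulVec_eq`.  The tools
`coe_eq_one_or_eq_neg_one_of_mul_self_eq_one` (`det g = 1`, `g² = 1` ⟹ `g = ±1`),
`mem_normalizer_unitGroup_adjoinElem_of_conj_mem` and `mem_zpowers_of_orderOf_eq_three` serve the
case `p = 5` of the sequel.

References: J.-P. Serre, Invent. Math. 15 (1972), §2.2 (Prop. 14), §2.4 (Prop. 15), §2.7
(Prop. 17) [Serre1972].
-/

open Matrix
open scoped MatrixGroups

-- the summit and its single problem are both named `BirchSwinnertonDyer` (registry layout D-0017)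
set_option linter.dupNamespace false

namespace Summit.BirchSwinnertonDyer.BirchSwinnertonDyer.Rank1Residual.TwistedIm

open Literature.NumberTheory.GaloisRepresentations
open Literature.NumberTheory.GaloisRepresentations.GL2
open Literature.NumberTheory.GaloisRepresentations.Serre1972

section Field

variable {F : Type*} [Field F]

/-- In `GL₂`: `det g = 1` and `g² = 1` force `g = ±1` when `2 ≠ 0` (Cayley–Hamilton:
`tr(g) g = 2`). [folklore] -/
theorem coe_eq_one_or_eq_neg_one_of_mul_self_eq_one (h2 : (2 : F) ≠ 0) {g : GL (Fin 2) F}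
    (hdet : Matrix.det (g : Matrix (Fin 2) (Fin 2) F) = 1) (hg : g * g = 1) :
    (g : Matrix (Fin 2) (Fin 2) F) = 1 ∨ (g : Matrix (Fin 2) (Fin 2) F) = -1 := by
  have hch := cayley_hamilton_two (g : Matrix (Fin 2) (Fin 2) F)
  have hgg : (g : Matrix (Fin 2) (Fin 2) F) * g = 1 := by
    rw [← Units.val_mul, hg, Units.val_one]
  rw [hgg, hdet, one_smul] at hch
  -- `tr(g) • g = 2 • 1`
  have htr : (g : Matrix (Fin 2) (Fin 2) F).trace • (g : Matrix (Fin 2) (Fin 2) F) =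
      (2 : F) • (1 : Matrix (Fin 2) (Fin 2) F) := by
    rw [two_smul]
    calc (g : Matrix (Fin 2) (Fin 2) F).trace • (g : Matrix (Fin 2) (Fin 2) F)
        = ((g : Matrix (Fin 2) (Fin 2) F).trace • (g : Matrix (Fin 2) (Fin 2) F) - 1) + 1 := by
          rw [sub_add_cancel]
      _ = 1 + 1 := by rw [← hch]
  have ht0 : (g : Matrix (Fin 2) (Fin 2) F).trace ≠ 0 := by
    intro h0
    rw [h0, zero_smul] at htr
    have h := congrFun (congrFun htr 0) 0
    simp only [Matrix.zero_apply, Matrix.smul_apply, Matrix.one_apply_eq, smul_eq_mul,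
      mul_one] at h
    exact h2 h.symm
  set c : F := 2 / (g : Matrix (Fin 2) (Fin 2) F).trace with hc
  have hgc : (g : Matrix (Fin 2) (Fin 2) F) = c • 1 := by
    calc (g : Matrix (Fin 2) (Fin 2) F)
        = (g : Matrix (Fin 2) (Fin 2) F).trace⁻¹ •
            ((g : Matrix (Fin 2) (Fin 2) F).trace • (g : Matrix (Fin 2) (Fin 2) F)) := by
          rw [smul_smul, inv_mul_cancel₀ ht0, one_smul]
      _ = c • 1 := by rw [htr, smul_smul, hc, div_eq_inv_mul]
  have hc2 : c * c = 1 := by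
    have h := hdet
    rw [hgc, Matrix.det_smul, Matrix.det_one, mul_one, Fintype.card_fin, pow_two] at h
    exact h
  rcases mul_self_eq_one_iff.mp hc2 with h1 | h1
  · left
    rw [hgc, h1, one_smul]
  · right
    rw [hgc, h1, neg_one_smul]

/-- Conjugation by an antidiagonal matrix swaps the entries of `diag(1, u)`. [folklore] -/
theorem coe_conj_halfDiagonalHom_of_isAd {x : GL (Fin 2) F}
    (hx : GL2.IsAd (x : Matrix (Fin 2) (Fin 2) F)) (u : Fˣ) :
    ((x * halfDiagonalHom u * x⁻¹ : GL (Fin 2) F) : Matrix (Fin 2) (Fin 2) F) =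
      diagonal ![(u : F), 1] := by
  have hxu : IsUnit (x : Matrix (Fin 2) (Fin 2) F).det := (GL2.det_ne_zero x).isUnit
  rw [Units.val_mul, Units.val_mul, Matrix.coe_units_inv, coe_halfDiagonalHom,
    hx.mul_diagonal]
  simp only [Matrix.cons_val_one, Matrix.cons_val_zero]
  rw [Matrix.mul_assoc, Matrix.mul_nonsing_inv _ hxu, Matrix.mul_one]

/-- **The swap construction.** If `G` contains the split half-Cartan subgroup of `P`,
normalises the split Cartan subgroup `C` of `P` and is not contained in it, then for every
`u ∈ Fˣ` the element `h = P diag(u, u⁻¹) P⁻¹` lies in `G`: it has determinant `1` and the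
eigenvector `P e₁` with eigenvalue `u⁻¹` (`|F| ≥ 3`). [folklore] -/
theorem exists_mem_det_eq_one_mulVec_eq (hF : ∃ u : Fˣ, u ≠ 1) {G : Subgroup (GL (Fin 2) F)}
    {P : GL (Fin 2) F} (hPG : halfSplitCartan P ≤ G)
    (hGN : G ≤ Subgroup.normalizer (splitCartan P : Set (GL (Fin 2) F)))
    (hGC : ¬ G ≤ splitCartan P) (u : Fˣ) :
    ∃ h ∈ G, Matrix.GeneralLinearGroup.det h = 1 ∧
      (h : Matrix (Fin 2) (Fin 2) F) *ᵥ (P : Matrix (Fin 2) (Fin 2) F).col 1 =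
        ((u⁻¹ : Fˣ) : F) • (P : Matrix (Fin 2) (Fin 2) F).col 1 := by
  obtain ⟨w, hwG, hwC⟩ := SetLike.not_le_iff_exists.mp hGC
  have hwad : GL2.IsAd ((P⁻¹ * w * P : GL (Fin 2) F) : Matrix (Fin 2) (Fin 2) F) := by
    rcases (mem_normalizer_splitCartan_iff hF).mp (hGN hwG) with h | h
    · exact absurd (mem_splitCartan_iff.mpr h) hwC
    · exact h
  -- the elements `d v = P diag(1, v) P⁻¹` of the half-Cartan subgroup
  have hd : ∀ v : Fˣ, P * halfDiagonalHom v * P⁻¹ ∈ G := fun v ↦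
    hPG ⟨halfDiagonalHom v, by rw [← range_halfDiagonalHom]; exact ⟨v, rfl⟩, by
      rw [MulEquiv.coe_toMonoidHom, MulAut.conj_apply]⟩
  set x : GL (Fin 2) F := P⁻¹ * w * P with hx
  set h : GL (Fin 2) F :=
    (P * halfDiagonalHom u⁻¹ * P⁻¹) * (w * (P * halfDiagonalHom u * P⁻¹) * w⁻¹) with hh
  refine ⟨h, G.mul_mem (hd u⁻¹) (G.mul_mem (G.mul_mem hwG (hd u)) (G.inv_mem hwG)), ?_, ?_⟩
  · -- determinant
    rw [hh]
    simp only [map_mul, map_inv, det_halfDiagonalHom]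
    simp only [mul_inv_cancel_comm, inv_mul_cancel]
  · -- eigenvector: `P⁻¹ h P = diag(1, u⁻¹) · x diag(1, u) x⁻¹ = diag(u, u⁻¹)`
    have hconj : P⁻¹ * h * P = halfDiagonalHom u⁻¹ * (x * halfDiagonalHom u * x⁻¹) := by
      rw [hh, hx]; group
    have hK : ((P⁻¹ * h * P : GL (Fin 2) F) : Matrix (Fin 2) (Fin 2) F) =
        diagonal ![(u : F), ((u⁻¹ : Fˣ) : F)] := by
      rw [hconj, Units.val_mul, coe_conj_halfDiagonalHom_of_isAd hwad u, coe_halfDiagonalHom,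
        diagonal_mul_diagonal]
      congr 1
      ext i
      fin_cases i <;> simp
    have hmat : (h : Matrix (Fin 2) (Fin 2) F) * (P : Matrix (Fin 2) (Fin 2) F) =
        (P : Matrix (Fin 2) (Fin 2) F) * diagonal ![(u : F), ((u⁻¹ : Fˣ) : F)] := by
      rw [← hK, ← Units.val_mul, ← Units.val_mul]
      congr 1
      group
    have hcol : (P : Matrix (Fin 2) (Fin 2) F).col 1 =
        (P : Matrix (Fin 2) (Fin 2) F) *ᵥ Pi.single 1 1 := (mulVec_single_one _ _).symm
    rw [hcol, mulVec_mulVec, hmat, ← mulVec_mulVec, diagonal_mulVec_single, mulVec_single,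
      mulVec_single]
    ext i
    simp [mul_comm]

/-- If `g x g⁻¹` and `g⁻¹ x g` lie in `F[x]` (`x` non-scalar), then `g` normalises the Cartan-type
subgroup `F[x]ˣ` (`F[g x g⁻¹] = F[x]`, and conjugation maps `F[x]` into `F[g x g⁻¹]`).
[folklore] -/
theorem mem_normalizer_unitGroup_adjoinElem_of_conj_mem {x g : GL (Fin 2) F}
    (hxs : ∀ c : F, (x : Matrix (Fin 2) (Fin 2) F) ≠ c • 1)
    (hg : ((g * x * g⁻¹ : GL (Fin 2) F) : Matrix (Fin 2) (Fin 2) F) ∈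
      adjoinElem (x : Matrix (Fin 2) (Fin 2) F))
    (hg' : ((g⁻¹ * x * g : GL (Fin 2) F) : Matrix (Fin 2) (Fin 2) F) ∈
      adjoinElem (x : Matrix (Fin 2) (Fin 2) F)) :
    g ∈ Subgroup.normalizer
      (unitGroup (adjoinElem (x : Matrix (Fin 2) (Fin 2) F)) : Set (GL (Fin 2) F)) := by
  have hgu : IsUnit (g : Matrix (Fin 2) (Fin 2) F).det := (GL2.det_ne_zero g).isUnit
  -- conjugates of a non-scalar matrix are non-scalar
  have hns : ∀ (k : GL (Fin 2) F) (c : F),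
      ((k * x * k⁻¹ : GL (Fin 2) F) : Matrix (Fin 2) (Fin 2) F) ≠ c • 1 := by
    intro k c hk
    apply hxs c
    have hx : x = k⁻¹ * (k * x * k⁻¹) * k := by group
    have hku : IsUnit (k : Matrix (Fin 2) (Fin 2) F).det := (GL2.det_ne_zero k).isUnit
    rw [hx, Units.val_mul, Units.val_mul, hk, Matrix.coe_units_inv, Matrix.mul_smul,
      Matrix.mul_one, Matrix.smul_mul, Matrix.nonsing_inv_mul _ hku]
  have h1 : adjoinElem (((g * x * g⁻¹ : GL (Fin 2) F) : Matrix (Fin 2) (Fin 2) F)) =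
      adjoinElem (x : Matrix (Fin 2) (Fin 2) F) := adjoinElem_eq_of_mem hg (hns g)
  have h2 : adjoinElem (((g⁻¹ * x * g : GL (Fin 2) F) : Matrix (Fin 2) (Fin 2) F)) =
      adjoinElem (x : Matrix (Fin 2) (Fin 2) F) := by
    refine adjoinElem_eq_of_mem hg' ?_
    have := hns g⁻¹
    rwa [inv_inv] at this
  rw [Subgroup.mem_normalizer_iff]
  intro k
  rw [mem_unitGroup_iff, mem_unitGroup_iff]
  constructor
  · intro hk
    have hc := conj_mem_adjoinElem hk (R := (g : Matrix (Fin 2) (Fin 2) F))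
      (Q := (g : Matrix (Fin 2) (Fin 2) F)⁻¹) (Matrix.mul_nonsing_inv _ hgu)
    rw [Units.val_mul, Units.val_mul, Matrix.coe_units_inv]
    rw [Units.val_mul, Units.val_mul, Matrix.coe_units_inv] at h1
    rwa [h1] at hc
  · intro hk
    have hc := conj_mem_adjoinElem hk (R := (g : Matrix (Fin 2) (Fin 2) F)⁻¹)
      (Q := (g : Matrix (Fin 2) (Fin 2) F)) (Matrix.nonsing_inv_mul _ hgu)
    rw [Units.val_mul, Units.val_mul, Matrix.coe_units_inv, conj_cancel' _ hgu] at hc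
    rw [Units.val_mul, Units.val_mul, Matrix.coe_units_inv] at h2
    rwa [h2] at hc

/-- Two elements of order `3` in a finite group with fewer than `9` elements generate the same
subgroup (otherwise `⟨x⟩ × ⟨y⟩ → K`, `(a, b) ↦ a b`, would be injective). [folklore] -/
theorem mem_zpowers_of_orderOf_eq_three {K : Type*} [Group K] [Finite K] {x y : K}
    (hx : orderOf x = 3) (hy : orderOf y = 3) (hK : Nat.card K < 9) :
    y ∈ Subgroup.zpowers x := by
  classical
  by_contra hyx
  set A := Subgroup.zpowers x with hA
  set B := Subgroup.zpowers y with hB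
  have hcA : Nat.card A = 3 := by rw [hA, Nat.card_zpowers, hx]
  have hcB : Nat.card B = 3 := by rw [hB, Nat.card_zpowers, hy]
  have hAB : A ⊓ B = ⊥ := by
    have hdvd : Nat.card (A ⊓ B : Subgroup K) ∣ 3 := hcB ▸ Subgroup.card_dvd_of_le inf_le_right
    rcases (Nat.dvd_prime Nat.prime_three).mp hdvd with h1 | h3
    · exact Subgroup.eq_bot_of_card_eq _ h1
    · exfalso
      apply hyx
      have hBA : A ⊓ B = B :=
        Subgroup.eq_of_le_of_card_ge inf_le_right (by rw [h3, hcB])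
      have hyB : y ∈ B := Subgroup.mem_zpowers y
      rw [← hBA] at hyB
      exact hyB.1
  have hinj : Function.Injective (fun ab : A × B ↦ (ab.1 : K) * ab.2) := by
    rintro ⟨a, b⟩ ⟨a', b'⟩ h
    simp only at h
    have hq : ((a' : K)⁻¹ * a) = b' * (b : K)⁻¹ := by
      rw [inv_mul_eq_iff_eq_mul, ← mul_assoc, eq_mul_inv_iff_mul_eq]
      exact h
    have hin : ((a' : K)⁻¹ * a) ∈ A ⊓ B :=
      ⟨A.mul_mem (A.inv_mem a'.2) a.2, hq ▸ B.mul_mem b'.2 (B.inv_mem b.2)⟩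
    rw [hAB, Subgroup.mem_bot] at hin
    have ha : (a : K) = a' := by
      rw [inv_mul_eq_one] at hin
      exact hin.symm
    have hb : (b : K) = b' := by
      rw [ha] at h
      exact mul_left_cancel h
    exact Prod.ext (Subtype.ext ha) (Subtype.ext hb)
  have hle := Nat.card_le_card_of_injective _ hinj
  rw [Nat.card_prod, hcA, hcB] at hle
  omega

end Field

section Prime

variable {p : ℕ} [Fact p.Prime]

/-- **Case `p ≠ 5`** (so `p ≥ 7`): Prop. 17 and Prop. 14 put `G` in the normaliser of the split
Cartan subgroup of `P`, outside the subgroup itself, and the swap construction concludes.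
[cite: Serre1972, §2.7 Prop. 17 and §2.2 Prop. 14] -/
theorem exists_det_one_eigenvalue_sq_ne_one_of_ne_five (hp5 : 5 ≤ p) (hp5' : p ≠ 5)
    (G : Subgroup (GL (Fin 2) (ZMod p))) {P : GL (Fin 2) (ZMod p)}
    (hPG : halfSplitCartan P ≤ G)
    (hirr : ∀ (v : Fin 2 → ZMod p) (hv : v ≠ 0), ¬ G ≤ eigenvectorStabilizer v hv)
    (hG : G ≠ ⊤) :
    ∃ h ∈ G, Matrix.GeneralLinearGroup.det h = 1 ∧
      ∃ (a : (ZMod p)ˣ) (v : Fin 2 → ZMod p), v ≠ 0 ∧ a ^ 2 ≠ 1 ∧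
        (h : Matrix (Fin 2) (Fin 2) (ZMod p)) *ᵥ v = (a : ZMod p) • v := by
  have hp2 : p ≠ 2 := by omega
  have hF : ∃ u : (ZMod p)ˣ, u ≠ 1 := exists_units_ne_one hp2
  obtain ⟨u, hu⟩ := exists_units_sq_ne_one hp5
  have hu' : u⁻¹ ^ 2 ≠ 1 := by
    intro h1
    apply hu
    rw [inv_pow, inv_eq_one] at h1
    exact h1
  -- Prop. 17 and Prop. 14
  have hN : G ≤ Subgroup.normalizer (splitCartan P : Set (GL (Fin 2) (ZMod p))) ∧
      ¬ G ≤ splitCartan P := by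
    rcases prop17_cases_halfSplitCartan G hp5' P hPG with h | ⟨v, hv, hB⟩ | ⟨C, hC, hGC⟩ |
        ⟨C, hC, hGN, hGC⟩
    · exact absurd h hG
    · exact absurd hB (hirr v hv)
    · have hCP : C = splitCartan P :=
        eq_splitCartan_of_halfSplitCartan_le_normalizer hC hp5
          (hPG.trans (hGC.trans Subgroup.le_normalizer))
      rw [hCP] at hGC
      exact absurd (hGC.trans (splitCartan_le_eigenvectorStabilizer P)) (hirr _ (col_ne_zero P 0))
    · have hCP : C = splitCartan P :=
        eq_splitCartan_of_halfSplitCartan_le_normalizer hC hp5 (hPG.trans hGN)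
      rw [hCP] at hGN hGC
      exact ⟨hGN, hGC⟩
  obtain ⟨h, hhG, hdet, hv⟩ := exists_mem_det_eq_one_mulVec_eq hF hPG hN.1 hN.2 u
  exact ⟨h, hhG, hdet, u⁻¹, _, col_ne_zero P 1, hu', hv⟩

end Prime

end Summit.BirchSwinnertonDyer.BirchSwinnertonDyer.Rank1Residual.TwistedIm
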